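import Mathlib
import Literature.NumberTheory.GaloisRepresentations.AbsGaloisOuterConj
import Literature.NumberTheory.GaloisRepresentations.HeckeCharacterGaloisAvatarProofs
import Literature.NumberTheory.GaloisRepresentations.FrobeniusDensity
import Literature.NumberTheory.GaloisRepresentations.GaloisRepFrobeniusProofs
import Literature.NumberTheory.GaloisRepresentations.TwistedSumFiniteOrderContinuous
import Literature.NumberTheory.Automorphic.ChebotarevArtinRepHolds

/-!
# The engine of line `kummer-chebotarev-separating-twists`: one-generator cyclic unscrewing with
# `τ`-halving — stub `stub_cyclicUnscrewing` of the crux `TwistUnpackaging` (stmt-Langlands-10903)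

Route `QuadraticWindow`, crux `Summit.Langlands.Langlands.Theses.QuadraticWindow.TwistUnpackaging`
(extraction of `ρ_π : Γ_F → GL_n(ℚ̄_ℓ)` from the controlled family of induced packages
`R_ψ : Γ_{F₀} → GL_{2n}(ℚ̄_ℓ)` of a quadratic `F/F₀`).  This file proves the ENGINE stub of the
line (registered signature, `ledger workitem stubs stmt-Langlands-10903`): from the packages of ONE
twist `ψ` of prime exponent `p > 16 d²` and of all but at most one of its powers, restricted to
`Γ_F` (`C j`, `j ∈ J`, with Frobenius roots `S_w ψ̃(w)^{-j} ⊔ S_{τw} ψ̃(τw)^{-j}` at every place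
`w ∉ E`), a continuous semisimple `τ`-halving `ρ` of `A = C 0`
(`charpoly A g = charpoly ρ g · charpoly ρ (θ_t g)`, `θ_t = absGaloisOuterConj F₀ F t`) whose
Frobenius roots are `S_w` wherever the ratio `ψ(τw)/ψ(w) ≠ 1`.

The mathematics is the group-theoretic extraction step of R. Taylor, *l-adic representations
associated to modular forms over imaginary quadratic fields. II*, Invent. Math. 116 (1994), §3, in
the finite-order form proved in the tree as
`Literature.NumberTheory.GaloisRepresentations.TwistedSum.exists_framedRep_of_cyclic_twist`
(`TwistedSumFiniteOrderContinuous`: Brauer–Nesbitt identities from characters on a dense set of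
Frobenii, a generic exponent, Krull–Schmidt unscrewing `exists_halving_of_generic_twist`, mass
separation of root multisets, framing).  Here we only TRANSPORT the Galois data to that theorem:

* `θ := θ_t` is a continuous automorphism of `Γ_F` (`absGaloisOuterConj_bijective`) with `θ ∘ θ`
  inner (`t² ∈ res(Γ_F)` because `τ² = 1`: `absGaloisQuot_eq_one_iff`,
  `absGaloisOuterConj_absGaloisRestrict_apply`);
* `μ := ` the `ℓ`-adic character of the Artin avatar `e₁` (`FramedArtinRep.lAdicChar`, continuous by
  its open kernel), `μ^p = 1`, `μ ∘ θ ∘ θ = μ`, Frobenius value `ι⁻¹(c w)⁻¹` at `w ∉ E`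
  (`FramedGaloisRep.hasFrobCharpolyAt_iff_of_rank_one`);
* `θ` carries an arithmetic Frobenius at `𝔓 ∣ w` to one at `t ⋆ 𝔓 ∣ τ • w`
  (`isArithFrobAt_absGaloisOuterConj_iff`, `outerConjIdeal_mem_primesAbove`);
* the dense set is that of Frobenii at places outside `E` (`absoluteGaloisGroup.frobenius_dense`
  with the tree's `chebotarev_artinRep_holds`);
* `d = 0` is the trivial case `ρ = 1`.
-/

set_option linter.dupNamespace false -- project-wide option (lakefile weak.linter.dupNamespace); `Summit.Langlands.Langlands` is the mandated namespace

open Literature.NumberTheory.GaloisRepresentations Literature.NumberTheory.Automorphic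
open IsDedekindDomain NumberField Filter Polynomial

namespace Summit.Langlands.Langlands.Theorems.TwistUnpackaging.KummerChebotarev

/-- **Stub D (the engine) — one-generator cyclic unscrewing with `τ`-halving.**  `F/F₀` quadratic
Galois, `t ∈ Γ_{F₀}` lifting `τ`, `θ = absGaloisOuterConj F₀ F t`; `e₁` a rank-one Artin avatar
of exponent `p` (`p` prime, `p > 16 d²`) with Frobenius value `c w` at every `w` outside a finite
`τ`-stable `E`, and non-trivial ratio `c (τ • w₀) ≠ c w₀` somewhere; `S w` (`w ∉ E`) `d`-element
multisets of non-zero `ℓ`-adic numbers; `C j` (`j ∈ J`, `0 ∈ J ⊇` all but at most one exponent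
`< p`) continuous semisimple `Γ_F → GL_{2d}(ℚ̄_ℓ)` with `charpoly (C 0) ∘ θ = charpoly (C 0)` and
characteristic roots `ι⁻¹(c_w^j)⁻¹ • S_w + ι⁻¹(c_{τw}^j)⁻¹ • S_{τw}` at every arithmetic Frobenius
at every `w ∉ E`.  Then there is a continuous semisimple `ρ : Γ_F → GL_d(ℚ̄_ℓ)` with
`charpoly (C 0) g = charpoly ρ g · charpoly ρ (θ g)` for all `g` whose Frobenius roots are `S_w` at
every `w ∉ E` where `c (τ • w) ≠ c w`.  Proof: transport to
`TwistedSum.exists_framedRep_of_cyclic_twist` (module docstring); Taylor 1994, §3. -/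
theorem stub_cyclicUnscrewing :
    ∀ (F₀ F : Type) [Field F₀] [NumberField F₀] [Field F] [NumberField F] [Algebra F₀ F]
      [IsGalois F₀ F] (τ : F ≃ₐ[F₀] F), Module.finrank F₀ F = 2 → τ ≠ 1 →
    ∀ (t : Field.absoluteGaloisGroup F₀), absGaloisQuot F₀ F t = τ →
    ∀ (ℓ : ℕ) [Fact ℓ.Prime] (ι : PadicAlgCl ℓ ≃+* ℂ) (d p : ℕ), p.Prime → 16 * d ^ 2 < p →
    ∀ (e₁ : FramedGaloisRep F ℂ 1) (c : HeightOneSpectrum (𝓞 F) → ℂ)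
      (E : Set (HeightOneSpectrum (𝓞 F))) (S : HeightOneSpectrum (𝓞 F) → Multiset (PadicAlgCl ℓ))
      (J : Set ℕ) (C : ℕ → FramedGaloisRep F (PadicAlgCl ℓ) (2 * d)),
      E.Finite → (∀ w ∉ E, τ • w ∉ E) →
      (∀ g : Field.absoluteGaloisGroup F, (e₁ g) ^ p = 1) →
      (∀ w ∉ E, e₁.HasFrobCharpolyAt w (Polynomial.X - Polynomial.C (c w))) →
      (∃ w₀, w₀ ∉ E ∧ c (τ • w₀) ≠ c w₀) →
      (∀ w ∉ E, Multiset.card (S w) = d ∧ (0 : PadicAlgCl ℓ) ∉ S w) →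
      0 ∈ J → (Set.Iio p \ J).Subsingleton →
      (∀ j ∈ J, (C j).toGaloisRep.IsSemisimple) →
      (∀ g : Field.absoluteGaloisGroup F,
          FramedRep.charpoly (C 0) (absGaloisOuterConj F₀ F t g) = FramedRep.charpoly (C 0) g) →
      (∀ j ∈ J, ∀ w ∉ E, ∀ 𝔓 ∈ w.primesAbove, ∀ σ : Field.absoluteGaloisGroup F,
          IsArithFrobAt (𝓞 F) σ 𝔓 →
          (FramedRep.charpoly (C j) σ).roots =
            (S w).map (fun x ↦ x * (ι.symm (c w ^ j))⁻¹) +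
            (S (τ • w)).map (fun x ↦ x * (ι.symm (c (τ • w) ^ j))⁻¹)) →
    ∃ ρ : FramedGaloisRep F (PadicAlgCl ℓ) d,
      ρ.toGaloisRep.IsSemisimple ∧
      (∀ g : Field.absoluteGaloisGroup F, FramedRep.charpoly (C 0) g =
          FramedRep.charpoly ρ g * FramedRep.charpoly ρ (absGaloisOuterConj F₀ F t g)) ∧
      ∀ w ∉ E, ∀ 𝔓 ∈ w.primesAbove, ∀ σ : Field.absoluteGaloisGroup F, IsArithFrobAt (𝓞 F) σ 𝔓 →
        c (τ • w) ≠ c w → (FramedRep.charpoly ρ σ).roots = S w := by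
  intro F₀ F _ _ _ _ _ _ τ hdeg hτ t ht ℓ _ ι d p hp hdp e₁ c E S J C hE hEτ hep hec hw₀ hS h0J hJ hss
    hθ0 hroots
  classical
  set θc := absGaloisOuterConj F₀ F t with hθc
  /- 1. `τ² = 1`, and `θ ∘ θ` is inner. -/
  haveI : FiniteDimensional F₀ F := Module.finite_of_finrank_eq_succ hdeg
  have hcardG : Fintype.card (F ≃ₐ[F₀] F) = 2 := by
    apply le_antisymm (hdeg ▸ AlgEquiv.card_le)
    haveI : Nontrivial (F ≃ₐ[F₀] F) := ⟨⟨τ, 1, hτ⟩⟩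
    exact Fintype.one_lt_card
  have hττ : τ * τ = 1 := by
    have h := pow_card_eq_one (G := F ≃ₐ[F₀] F) (x := τ)
    rwa [hcardG, pow_two] at h
  have hτw : ∀ w : HeightOneSpectrum (𝓞 F), τ • τ • w = w := fun w => by
    rw [← mul_smul, hττ, one_smul]
  obtain ⟨s₀, hs₀⟩ : ∃ s₀, absGaloisRestrict F₀ F s₀ = t * t :=
    (absGaloisQuot_eq_one_iff F₀ F (t * t)).1 (by rw [map_mul, ht, hττ])
  have hθθ : ∀ g, θc (θc g) = s₀ * g * s₀⁻¹ := fun g => by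
    rw [hθc, ← absGaloisOuterConj_mul_apply, ← hs₀, absGaloisOuterConj_absGaloisRestrict_apply]
  /- 2. The continuous character `μ = ι⁻¹ ∘ (det e₁)⁻¹` and its properties. -/
  let μ : Field.absoluteGaloisGroup F →ₜ* (PadicAlgCl ℓ)ˣ :=
    ⟨FramedArtinRep.lAdicChar e₁ ι,
      MonoidHom.continuous_of_isOpen_ker _ (FramedArtinRep.isOpen_ker_lAdicChar e₁ ι)⟩
  have hμapp : ∀ g, μ g = FramedArtinRep.lAdicChar e₁ ι g := fun g => rfl
  have hμp : ∀ g, μ g ^ p = 1 := fun g => by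
    rw [hμapp, ← map_pow, FramedArtinRep.lAdicChar_apply_eq_one_iff, map_pow]
    exact hep g
  have hμθθ : ∀ g, μ (θc (θc g)) = μ g := fun g => by
    rw [hθθ, map_mul, map_mul, map_inv, mul_comm (μ s₀), mul_assoc, mul_inv_cancel, mul_one]
  have hμval : ∀ w ∉ E, ∀ 𝔓 ∈ w.primesAbove, ∀ σ : Field.absoluteGaloisGroup F,
      IsArithFrobAt (𝓞 F) σ 𝔓 → ((μ σ : (PadicAlgCl ℓ)ˣ) : PadicAlgCl ℓ) = (ι.symm (c w))⁻¹ := by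
    intro w hw 𝔓 h𝔓 σ hσ
    have h := (FramedGaloisRep.hasFrobCharpolyAt_iff_of_rank_one e₁ w (c w)).1 (hec w hw) 𝔓 h𝔓 σ hσ
    rw [hμapp, FramedArtinRep.coe_lAdicChar_apply, FramedRep.det_apply,
      Matrix.GeneralLinearGroup.val_det_apply, Matrix.det_fin_one, h]
  have hμpow : ∀ w ∉ E, ∀ 𝔓 ∈ w.primesAbove, ∀ σ : Field.absoluteGaloisGroup F,
      IsArithFrobAt (𝓞 F) σ 𝔓 → ∀ j : ℕ,
        (ι.symm (c w ^ j))⁻¹ = ((μ σ : (PadicAlgCl ℓ)ˣ) : PadicAlgCl ℓ) ^ j := by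
    intro w hw 𝔓 h𝔓 σ hσ j
    rw [hμval w hw 𝔓 h𝔓 σ hσ, map_pow, inv_pow]
  /- 3. Frobenii transport along `θ`. -/
  have hθfrob : ∀ (w : HeightOneSpectrum (𝓞 F)) (𝔓 : Ideal (absIntegers (𝓞 F) F)),
      𝔓 ∈ w.primesAbove → ∀ σ : Field.absoluteGaloisGroup F, IsArithFrobAt (𝓞 F) σ 𝔓 →
      ∃ 𝔓' ∈ (τ • w).primesAbove, IsArithFrobAt (𝓞 F) (θc σ) 𝔓' := by
    intro w 𝔓 h𝔓 σ hσ
    refine ⟨outerConjIdeal t 𝔓, ?_, (isArithFrobAt_absGaloisOuterConj_iff h𝔓 t σ).2 hσ⟩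
    have h := outerConjIdeal_mem_primesAbove h𝔓 t
    rwa [ht] at h
  -- the root data in the `μ`-form, at `σ` and at `θ σ`
  have hdata : ∀ w ∉ E, ∀ 𝔓 ∈ w.primesAbove, ∀ σ : Field.absoluteGaloisGroup F,
      IsArithFrobAt (𝓞 F) σ 𝔓 →
      ((μ (θc σ) : (PadicAlgCl ℓ)ˣ) : PadicAlgCl ℓ) = (ι.symm (c (τ • w)))⁻¹ ∧
      (∀ j ∈ J, (FramedRep.charpoly (C j) σ).roots =
        (S w).map (· * ((μ σ : (PadicAlgCl ℓ)ˣ) : PadicAlgCl ℓ) ^ j) +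
        (S (τ • w)).map (· * ((μ (θc σ) : (PadicAlgCl ℓ)ˣ) : PadicAlgCl ℓ) ^ j)) ∧
      (∀ j ∈ J, (FramedRep.charpoly (C j) (θc σ)).roots =
        (S (τ • w)).map (· * ((μ (θc σ) : (PadicAlgCl ℓ)ˣ) : PadicAlgCl ℓ) ^ j) +
        (S w).map (· * ((μ σ : (PadicAlgCl ℓ)ˣ) : PadicAlgCl ℓ) ^ j)) := by
    intro w hw 𝔓 h𝔓 σ hσ
    obtain ⟨𝔓', h𝔓', hσ'⟩ := hθfrob w 𝔓 h𝔓 σ hσ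
    have hτwE : τ • w ∉ E := hEτ w hw
    refine ⟨hμval (τ • w) hτwE 𝔓' h𝔓' (θc σ) hσ', fun j hj => ?_, fun j hj => ?_⟩
    · rw [hroots j hj w hw 𝔓 h𝔓 σ hσ, hμpow w hw 𝔓 h𝔓 σ hσ j,
        hμpow (τ • w) hτwE 𝔓' h𝔓' (θc σ) hσ' j]
    · have h := hroots j hj (τ • w) hτwE 𝔓' h𝔓' (θc σ) hσ'
      rw [hτw] at h
      rw [h, hμpow w hw 𝔓 h𝔓 σ hσ j, hμpow (τ • w) hτwE 𝔓' h𝔓' (θc σ) hσ' j]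
  -- non-triviality of the ratio at a place
  have hratio : ∀ w ∉ E, ∀ 𝔓 ∈ w.primesAbove, ∀ σ : Field.absoluteGaloisGroup F,
      IsArithFrobAt (𝓞 F) σ 𝔓 → c (τ • w) ≠ c w → μ (θc σ) ≠ μ σ := by
    intro w hw 𝔓 h𝔓 σ hσ hcw heq
    apply hcw
    have h1 := (hdata w hw 𝔓 h𝔓 σ hσ).1
    rw [heq, hμval w hw 𝔓 h𝔓 σ hσ, inv_inj] at h1
    exact ι.symm.injective h1.symm
  /- 4. The degenerate rank `d = 0`. -/
  rcases Nat.eq_zero_or_pos d with hd0 | hdpos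
  · subst hd0
    haveI hE0 : IsEmpty (Fin (2 * 0)) := show IsEmpty (Fin 0) from inferInstance
    refine ⟨1, ?_, fun g => ?_, fun w hw 𝔓 h𝔓 σ hσ _ => ?_⟩
    · haveI : Subsingleton (Submodule (PadicAlgCl ℓ) (Fin 0 → PadicAlgCl ℓ)) :=
        (Submodule.subsingleton_iff (PadicAlgCl ℓ)).2 inferInstance
      haveI : Subsingleton (Subrepresentation
          ((1 : FramedGaloisRep F (PadicAlgCl ℓ) 0).toGaloisRep.toRepresentation)) :=
        ⟨fun a b => Subrepresentation.toSubmodule_injective (Subsingleton.elim _ _)⟩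
      exact Subsingleton.instComplementedLattice
    · rw [FramedRep.charpoly, FramedRep.charpoly, FramedRep.charpoly, Matrix.charpoly_isEmpty,
        Matrix.charpoly_isEmpty, Matrix.charpoly_isEmpty, one_mul]
    · rw [FramedRep.charpoly, Matrix.charpoly_isEmpty, Polynomial.roots_one]
      exact (Multiset.card_eq_zero.1 (hS w hw).1).symm
  /- 5. The main case: transport to `TwistedSum.exists_framedRep_of_cyclic_twist`. -/
  set D : Set (Field.absoluteGaloisGroup F) :=
    {σ | ∃ w ∉ E, ∃ 𝔓 ∈ w.primesAbove, IsArithFrobAt (𝓞 F) σ 𝔓} with hD_def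
  have hD : Dense D := absoluteGaloisGroup.frobenius_dense chebotarev_artinRep_holds F E hE
  have hroots' : ∀ σ ∈ D, ∃ S₁ S₂ : Multiset (PadicAlgCl ℓ), Multiset.card S₁ = d ∧
      Multiset.card S₂ = d ∧ (0 : PadicAlgCl ℓ) ∉ S₁ ∧ (0 : PadicAlgCl ℓ) ∉ S₂ ∧
      (∀ j ∈ J, (FramedRep.charpoly (C j) σ).roots =
        S₁.map (· * ((μ σ : (PadicAlgCl ℓ)ˣ) : PadicAlgCl ℓ) ^ j) +
        S₂.map (· * ((μ (θc σ) : (PadicAlgCl ℓ)ˣ) : PadicAlgCl ℓ) ^ j)) ∧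
      (∀ j ∈ J, (FramedRep.charpoly (C j) (θc σ)).roots =
        S₂.map (· * ((μ (θc σ) : (PadicAlgCl ℓ)ˣ) : PadicAlgCl ℓ) ^ j) +
        S₁.map (· * ((μ σ : (PadicAlgCl ℓ)ˣ) : PadicAlgCl ℓ) ^ j)) := by
    rintro σ ⟨w, hw, 𝔓, h𝔓, hσ⟩
    obtain ⟨-, h1, h2⟩ := hdata w hw 𝔓 h𝔓 σ hσ
    exact ⟨S w, S (τ • w), (hS w hw).1, (hS (τ • w) (hEτ w hw)).1, (hS w hw).2,
      (hS (τ • w) (hEτ w hw)).2, h1, h2⟩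
  have hne : ∃ σ ∈ D, μ (θc σ) ≠ μ σ := by
    obtain ⟨w₀, hw₀, hcw₀⟩ := hw₀
    obtain ⟨𝔓, h𝔓⟩ := HeightOneSpectrum.primesAbove_nonempty w₀
    obtain ⟨σ, hσ⟩ := HeightOneSpectrum.exists_isArithFrobAt_of_mem_primesAbove_holds h𝔓
    exact ⟨σ, ⟨w₀, hw₀, 𝔓, h𝔓, hσ⟩, hratio w₀ hw₀ 𝔓 h𝔓 σ hσ hcw₀⟩
  obtain ⟨ρ, hρss, hρsplit, hρroots⟩ := TwistedSum.exists_framedRep_of_cyclic_twist D hD d p hp hdp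
    hdpos θc (absGaloisOuterConj_bijective F₀ F t) μ hμp hμθθ J h0J hJ C hss hθ0 hroots' hne
  refine ⟨ρ, hρss, hρsplit, fun w hw 𝔓 h𝔓 σ hσ hcw => ?_⟩
  exact hρroots σ ⟨w, hw, 𝔓, h𝔓, hσ⟩ (hratio w hw 𝔓 h𝔓 σ hσ hcw) (S w) (S (τ • w)) (hS w hw).2
    (hS (τ • w) (hEτ w hw)).2 (hS (τ • w) (hEτ w hw)).1 (hdata w hw 𝔓 h𝔓 σ hσ).2.1

end Summit.Langlands.Langlands.Theorems.TwistUnpackaging.KummerChebotarev
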